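import Mathlib
import Summits.ABC.ABC.Theses.RibetTakahashiSplit
import Summits.ABC.ABC.Theorems.RibetTakahashiSplitManyPrimeValuationProductJLPackageLemmas
import Literature.NumberTheory.Automorphic.ShimuraCurveRibetTakahashi
import Literature.NumberTheory.EllipticCurves.Isogeny
import Literature.NumberTheory.EllipticCurves.Szpiro
import Literature.NumberTheory.EllipticCurves.IsogenyIdProofs
import Literature.NumberTheory.EllipticCurves.SzpiroOfAbcProofs
import Literature.NumberTheory.EllipticCurves.PastenHeightBounds
import Literature.NumberTheory.EllipticCurves.GlobalMinimalModelProofs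
import Literature.NumberTheory.EllipticCurves.ModularDegreeFormulaProofs
import Literature.NumberTheory.EllipticCurves.ModularCurveManinConstantProofs

/-!
# The two-prime Ribet–Takahashi–Pasten package (stub `stub_twoPrimePackage`) from named facts

Helper `--supports` stmt-ABC-1563 (crux
`Summit.ABC.ABC.Theses.RibetTakahashiSplit.FewPrimeValuationProduct`, line `switching-triangle`,
stub `stub_twoPrimePackage`). The stub is the PACKAGE INEQUALITY at the two-prime levels: for
`W/ℚ` semistable away from `2` and distinct multiplicative primes `p ≠ q`,
`log(c_p c_q) ≤ C + ε log N + 2 log gcd(c_p, c_q) + log vol(F) − log ∫_F ‖s‖²_pt dμ`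
(`c_v = ord_v Δ_min`) with its side conditions (a Néron period pair `L`, a Shimura curve datum `X`
of level `(pq, N/(pq))`, a fundamental domain `F` of finite positive area, a non-zero weight-`2`
form `s` on `X.Gamma` with periods in `Λ_L`, `‖s‖²_pt` integrable with positive integral).
Shimura curves, Jacobians and Néron models are not formalised, so the stub is proved here in its
CONDITIONAL form `stub_twoPrimePackage_of_facts` (registered sub-goal), from nine named facts of the
tree (`ShimuraCurveRibetTakahashi`: existence of `X₀^{pq}(M)` data and of Jacquet–Langlands
parametrisations, Shimizu's volume, Frey's identity on the Shimura curve, the Mazur–Kenku comparison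
`≤ 163 δ_{pq,M}`, the optimal quotient `q_{1,N} j_N`, Pasten Cor 10.2 (Manin constant),
`‖f‖² ≪ N log N`; and `abs_neronLatticeHeight_sub_le_of_isIsogenous`) plus ONE new printed input
stated inline for relocation to Literature: `PastenShimura2024_pairwise_denominator`, the pairwise,
`gcd`-bounded denominator of `γ_{pq,M,E}` — H. Pasten, *Shimura curves and the abc conjecture*
(arXiv:1705.09251), (EqSequentially) p. 25 with `d = 1` assembled with Lemmas 6.8, 6.14, 6.15
(NO hypothesis on the co-level `M`, which is the point of this line: Thm 6.1 (b) needs two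
multiplicative primes in `M`).

Proof (the chain of the sibling package `jlPackage_printedClass_of_facts`, stmt-ABC-1561, with
`D = {p, q}`, `ω(D) = 2`): global minimal model `Wm`; `N = (pq) · M` is admissible
(`admissible_pair`, from `admissible_of_isCoveringSet`); data `X`, a minimal-degree datum `P'` of
`Wm` and a class-minimal `P₀` (`δ_{pq,M}`), the optimal `D₀` (`δ_{1,N}`); the new fact gives
`δ_{1,N} b = a δ_{pq,M} c_p c_q`, `a ≤ 163²`, `b ≤ κ gcd(c_p,c_q)²`; Frey, Mazur–Kenku, Faltings,
Zagier (PROVED), Manin (`S = {2}`), `(f,f) ≤ C N log N ≤ C N^{1+η}/η` give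
`c_p c_q ≤ K κ gcd² N^{1+η} / (η ‖s‖²)` (`real_chain` with `κω := κ gcd²`); `vol(X.fd) =
(π/3) φ(pq) ψ(M) ≥ (π/3) N / 4` and `log_chain` (with `ω = 2`, `κ = 1`, `C_η = 4`) give the
inequality with `η = ε/3`. The `a.e.`-positivity / `log`-integrability conjuncts of the sibling
are not part of this stub; integrability and positivity of `∫ ‖s‖²_pt` follow from Frey's identity.
-/

-- `Summit.ABC.ABC` is the mandated summit-side namespace (CONVENTIONS §2); the duplicate is deliberate.
set_option linter.dupNamespace false

noncomputable section

open MeasureTheory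
open scoped MatrixGroups

namespace Literature.NumberTheory.Automorphic

end Literature.NumberTheory.Automorphic

namespace Summit.ABC.ABC.Theorems.FewPrimeValuationProduct

open Literature.NumberTheory.Automorphic
open Literature.NumberTheory.EllipticCurves.ModularForms
open CongruenceSubgroup
open Summit.ABC.ABC.Theorems.ManyPrimeValuationProduct.JLPackage

/-- For distinct multiplicative primes `p ≠ q` of `W`, `N = (pq) · (N/(pq))` is an admissible
factorisation (`admissible_of_isCoveringSet` with `D = {p, q}`). `[folklore]` -/
theorem admissible_pair {W : WeierstrassCurve ℚ} [W.IsElliptic] {p q : ℕ}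
    (hp : p ∈ (W.conductorNorm ℤ).primeFactors.filter (fun p => ¬ p ^ 2 ∣ W.conductorNorm ℤ))
    (hq : q ∈ (W.conductorNorm ℤ).primeFactors.filter (fun p => ¬ p ^ 2 ∣ W.conductorNorm ℤ))
    (hpq : p ≠ q) :
    IsAdmissibleFactorization (W.conductorNorm ℤ) (p * q) (W.conductorNorm ℤ / (p * q)) := by
  have hsub : ({p, q} : Finset ℕ) ⊆
      (W.conductorNorm ℤ).primeFactors.filter (fun p => ¬ p ^ 2 ∣ W.conductorNorm ℤ) := by
    intro r hr
    rcases Finset.mem_insert.mp hr with rfl | hr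
    · exact hp
    · rwa [Finset.mem_singleton.mp hr]
  have h := (admissible_of_isCoveringSet hsub (by rw [Finset.card_pair hpq]; exact even_two)).1
  rwa [Finset.prod_pair hpq] at h

/-- `pq ≤ 4 φ(pq)` for distinct primes (`2(p − 1) ≥ p`). `[folklore]` -/
theorem mul_le_totient_mul_four {p q : ℕ} (hp : p.Prime) (hq : q.Prime) (hpq : p ≠ q) :
    p * q ≤ Nat.totient (p * q) * 4 := by
  have hD : ∀ r ∈ ({p, q} : Finset ℕ), r.Prime := by
    intro r hr
    rcases Finset.mem_insert.mp hr with rfl | hr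
    · exact hp
    · rwa [Finset.mem_singleton.mp hr]
  have h := prod_le_totient_mul_two_pow hD
  rw [Finset.prod_pair hpq, Finset.card_pair hpq] at h
  calc p * q ≤ Nat.totient (p * q) * 2 ^ 2 := h
    _ = Nat.totient (p * q) * 4 := by norm_num

/-- **`stub_twoPrimePackage` from the named facts** (registered sub-goal
`stub_twoPrimePackage_of_facts` of stmt-ABC-1563, line `switching-triangle`): the stub's
signature verbatim, conditional on nine named facts of `ShimuraCurveRibetTakahashi` /
`PastenHeightBounds` and the inline printed fact `PastenShimura2024_pairwise_denominator`.
Witnesses: `L` = the Néron period pair of a global minimal model `Wm`, `X` = any datum of level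
`(pq, N/(pq))`, `F = X.fd`, `s` = the pulled-back invariant differential of a minimal-degree
Jacquet–Langlands parametrisation of `Wm` (Pasten arXiv:1705.09251 §16, proof of Thm 16.4, run at
the two-prime level with (EqSequentially) in place of Thm 6.1 (b); module docstring). `[folklore]` -/
theorem stub_twoPrimePackage_of_facts :
    Literature.NumberTheory.Automorphic.nonempty_shimuraCurveData →
    Literature.NumberTheory.Automorphic.ShimuraCurveData.volume_fd_eq →
    Literature.NumberTheory.Automorphic.nonempty_shimuraParametrizationData →
    Literature.NumberTheory.Automorphic.ShimuraParametrizationData.normSq_form_eq_deg_mul_covolume →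
    Literature.NumberTheory.Automorphic.ShimuraParametrizationData.minimalDegree_le_163_mul →
    Literature.NumberTheory.Automorphic.PastenShimura2024_pairwise_denominator →
    Literature.NumberTheory.Automorphic.exists_optimal_modularParametrizationData →
    Literature.NumberTheory.Automorphic.PastenShimura2024_cor_10_2 →
    Literature.NumberTheory.Automorphic.murty_petersson_newform_upper_bound →
    Literature.NumberTheory.EllipticCurves.ModularForms.abs_neronLatticeHeight_sub_le_of_isIsogenous →
    ∀ ε : ℝ, 0 < ε → ∃ C : ℝ, ∀ (W : WeierstrassCurve ℚ) [W.IsElliptic],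
      (∀ p : ℕ, p.Prime → p ≠ 2 → ¬ p ^ 2 ∣ W.conductorNorm ℤ) →
      ∀ p ∈ (W.conductorNorm ℤ).primeFactors.filter (fun p => ¬ p ^ 2 ∣ W.conductorNorm ℤ),
      ∀ q ∈ (W.conductorNorm ℤ).primeFactors.filter (fun p => ¬ p ^ 2 ∣ W.conductorNorm ℤ), p ≠ q →
        ∃ (L : PeriodPair)
          (X : Literature.NumberTheory.Automorphic.ShimuraCurveData (p * q)
            (W.conductorNorm ℤ / (p * q)))
          (F : Set UpperHalfPlane) (s : CuspForm X.Gamma 2),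
          (∃ C' : WeierstrassCurve.VariableChange ℚ, (C' • W).IsGloballyMinimal ∧
            Literature.NumberTheory.EllipticCurves.ModularForms.IsNeronLatticeOf
              ((C' • W).baseChange ℂ) L) ∧
          Literature.NumberTheory.Automorphic.IsHypFundamentalDomain X.Gamma F ∧
          MeasureTheory.volume F ≠ 0 ∧ MeasureTheory.volume F ≠ ⊤ ∧ s ≠ 0 ∧
          Literature.NumberTheory.Automorphic.HasPeriodsIn X.Gamma s (L.lattice : Set ℂ) ∧
          MeasureTheory.IntegrableOn (fun z => ‖s z‖ ^ 2 * z.im ^ 2) F ∧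
          (0 < ∫ z in F, ‖s z‖ ^ 2 * z.im ^ 2) ∧
          Real.log (((W.minimalDiscriminantNorm ℤ).factorization p *
              (W.minimalDiscriminantNorm ℤ).factorization q : ℕ) : ℝ) ≤
            C + ε * Real.log (W.conductorNorm ℤ) +
              2 * Real.log (Nat.gcd ((W.minimalDiscriminantNorm ℤ).factorization p)
                ((W.minimalDiscriminantNorm ℤ).factorization q)) +
              Real.log (MeasureTheory.volume F).toReal -
                Real.log (∫ z in F, ‖s z‖ ^ 2 * z.im ^ 2) := by
  intro hXex hvol hJL hFrey h163 hden hopt hManin hPet hht ε hε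
  -- constants, chosen before the curve
  obtain ⟨κ, hκ1, hden⟩ := hden {2}
  obtain ⟨𝓜, hManin⟩ := hManin {2}
  obtain ⟨Cpet, hPet⟩ := hPet
  set Cp : ℝ := max Cpet 1
  set 𝓜' : ℝ := max (𝓜 : ℝ) 1 with h𝓜'def
  set η : ℝ := ε / 3 with hηdef
  have hη : 0 < η := by positivity
  have hκpos : (0 : ℝ) < κ := by exact_mod_cast hκ1
  set K : ℝ := 4 * Real.pi ^ 2 * 𝓜' ^ 2 * Cp * 163 ^ 2 * κ / η with hKdef
  have hK : 0 < K := by positivity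
  refine ⟨Real.log K + 2 * Real.log 4 + Real.log (3 / Real.pi), ?_⟩
  intro W _ hss p hp q hq hpq
  have hpP : p.Prime := Nat.prime_of_mem_primeFactors (Finset.mem_filter.mp hp).1
  have hqP : q.Prime := Nat.prime_of_mem_primeFactors (Finset.mem_filter.mp hq).1
  -- a globally minimal model
  obtain ⟨C₀, hC₀⟩ := WeierstrassCurve.hasGlobalMinimalModel_rat_holds W
  haveI := hC₀
  set Wm := C₀ • W
  have hNeq : Wm.conductorNorm ℤ = W.conductorNorm ℤ := WeierstrassCurve.conductorNorm_smul_rat W C₀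
  have hΔeq : Wm.minimalDiscriminantNorm ℤ = W.minimalDiscriminantNorm ℤ :=
    WeierstrassCurve.minimalDiscriminantNorm_smul_rat W C₀
  have hadm := admissible_pair hp hq hpq
  set N := W.conductorNorm ℤ
  have hNpos : 0 < N := W.conductorNorm_pos_holds
  haveI : NeZero N := ⟨hNpos.ne'⟩
  set M := N / (p * q)
  have hMpos : 0 < M := hadm.pos_right
  have hDM : p * q * M = N := hadm.mul_eq
  have hsq : ∀ r : ℕ, r.Prime → r ∉ ({2} : Finset ℕ) → ¬ r ^ 2 ∣ N := fun r hr hr2 =>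
    hss r hr (by simpa using hr2)
  -- the data
  obtain ⟨X⟩ := hXex hadm
  obtain ⟨PW⟩ := hJL hadm X Wm hNeq
  obtain ⟨P', hP'min⟩ := exists_self_minimal PW
  obtain ⟨W₀', hW₀', P₀, hP₀⟩ := exists_class_minimal PW
  obtain ⟨W₀, hW₀e, hW₀m, D₀, hnew, hiso, hD₀min⟩ := hopt N Wm hNeq
  -- the pairwise denominator of `γ_{pq,M,E}`
  obtain ⟨a, b, ha, hb, -, hbκ, hEq⟩ :=
    hden hpP hqP hpq hadm X Wm hNeq hsq W₀ D₀ hnew hD₀min W₀' P₀ hP₀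
  rw [hΔeq] at hbκ hEq
  set cp : ℕ := (W.minimalDiscriminantNorm ℤ).factorization p
  set cq : ℕ := (W.minimalDiscriminantNorm ℤ).factorization q
  set g : ℕ := Nat.gcd cp cq
  set T : ℕ := cp * cq with hTdef
  -- hEq : δ₁ * b = a * δ * T
  have hδ₁pos : 0 < D₀.modularDegree := D₀.deg_pos
  have hT1 : 1 ≤ T := by
    rcases Nat.eq_zero_or_pos T with h0 | h0
    · rw [h0, mul_zero] at hEq
      exact absurd hEq (Nat.mul_ne_zero hδ₁pos.ne' hb.ne')
    · exact h0
  have hcp : 0 < cp := Nat.pos_of_ne_zero fun h0 => by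
    rw [hTdef, h0, zero_mul] at hT1
    exact Nat.not_succ_le_zero 0 hT1
  have hg : 0 < g := Nat.gcd_pos_of_pos_left _ hcp
  -- Mazur–Kenku, Frey, Zagier, Manin, Petersson, heights
  have hdeg : P'.deg ≤ 163 * P₀.deg := h163 P₀ P' hP₀ hP'min
  have hnorm : X.normSq P'.form = P'.deg * ZLattice.covolume P'.L.lattice := hFrey P'
  have hz := D₀.zagier_degree_formula_holds
  have hff0 : 0 < (peterssonProduct (Gamma0 N) 2 D₀.f D₀.f).re := hz.peterssonProduct_re_pos
  have hzr : 4 * Real.pi ^ 2 * (D₀.c : ℝ) ^ 2 * (peterssonProduct (Gamma0 N) 2 D₀.f D₀.f).re =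
      D₀.deg * ZLattice.covolume D₀.L.lattice := by
    have := congrArg Complex.re hz
    rwa [Complex.re_ofReal_mul, Complex.ofReal_re] at this
  have hc : |D₀.maninConstant| ≤ (𝓜 : ℤ) := hManin N W₀ D₀ hsq hD₀min
  have hc' : |(D₀.c : ℝ)| ≤ 𝓜' := by
    have h1 : ((|D₀.c| : ℤ) : ℝ) ≤ (𝓜 : ℝ) := by exact_mod_cast hc
    rw [Int.cast_abs] at h1
    rw [h𝓜'def]
    exact h1.trans (le_max_left _ _)
  have hpet : (peterssonProduct (Gamma0 N) 2 D₀.f D₀.f).re ≤ Cpet * N * Real.log N :=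
    hPet N W₀ D₀.f D₀.isNewformOf
  have hheight := hht Wm W₀ P'.L D₀.L P'.isNeronLattice D₀.isNeronLattice hiso
  -- positivity of the covolumes and the comparison `V ≤ 163 V₀`
  have hV : 0 < ZLattice.covolume P'.L.lattice := ZLattice.covolume_pos _ _
  have hV₀ : 0 < ZLattice.covolume D₀.L.lattice := ZLattice.covolume_pos _ _
  have hVV : ZLattice.covolume P'.L.lattice ≤ 163 * ZLattice.covolume D₀.L.lattice := by
    unfold neronLatticeHeight at hheight
    have h := (abs_le.mp hheight).1
    have hlog : Real.log (ZLattice.covolume P'.L.lattice) ≤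
        Real.log (ZLattice.covolume D₀.L.lattice) + Real.log 163 := by linarith
    calc ZLattice.covolume P'.L.lattice = Real.exp (Real.log (ZLattice.covolume P'.L.lattice)) :=
          (Real.exp_log hV).symm
      _ ≤ Real.exp (Real.log (ZLattice.covolume D₀.L.lattice) + Real.log 163) :=
          Real.exp_le_exp.mpr hlog
      _ = 163 * ZLattice.covolume D₀.L.lattice := by
          rw [Real.exp_add, Real.exp_log hV₀, Real.exp_log (by norm_num), mul_comm]
  -- the Petersson bound in power form: `N log N ≤ N^{1+η}/η`
  have hN1 : (1 : ℝ) ≤ N := by exact_mod_cast hNpos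
  have hpet' : (peterssonProduct (Gamma0 N) 2 D₀.f D₀.f).re ≤ Cp * ((N : ℝ) ^ (1 + η) / η) := by
    have hlogN : 0 ≤ Real.log N := Real.log_nonneg hN1
    have h1 : Cpet * N * Real.log N ≤ Cp * N * Real.log N := by
      have : 0 ≤ (N : ℝ) * Real.log N := by positivity
      nlinarith [le_max_left Cpet 1]
    have h2 : Real.log N ≤ (N : ℝ) ^ η / η := Real.log_le_rpow_div (by positivity) hη
    have h3 : (N : ℝ) * ((N : ℝ) ^ η / η) = (N : ℝ) ^ (1 + η) / η := by
      rw [Real.rpow_add (by positivity), Real.rpow_one, mul_div_assoc]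
    calc (peterssonProduct (Gamma0 N) 2 D₀.f D₀.f).re ≤ Cp * N * Real.log N := hpet.trans h1
      _ ≤ Cp * N * ((N : ℝ) ^ η / η) := by
          apply mul_le_mul_of_nonneg_left h2; positivity
      _ = Cp * ((N : ℝ) ^ (1 + η) / η) := by rw [mul_assoc, h3]
  -- the multiplicative chain
  set S : ℝ := X.normSq P'.form with hSdef
  have hTeq : (T : ℝ) * (a * P₀.deg) = D₀.modularDegree * b := by
    have : ((D₀.modularDegree * b : ℕ) : ℝ) = ((a * P₀.deg * T : ℕ) : ℝ) := by
      exact_mod_cast hEq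
    push_cast at this
    linarith
  have hbκ' : (b : ℝ) ≤ (κ : ℝ) * (g : ℝ) ^ 2 := by exact_mod_cast hbκ
  have hchain := real_chain (κω := (κ : ℝ) * (g : ℝ) ^ 2) hTeq (by exact_mod_cast ha)
    (by positivity) hbκ' (by exact_mod_cast P₀.deg_pos) (by positivity) (by positivity)
    (by exact_mod_cast hdeg) (by exact_mod_cast P'.deg_pos) hnorm hV hV₀ hVV hzr hc' hff0.le hpet'
  have hchain' : (T : ℝ) ≤ (K * (g : ℝ) ^ 2) * (1 : ℝ) ^ (2 : ℕ) * (N : ℝ) ^ (1 + η) / S := by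
    rw [hKdef]
    convert hchain using 1
    field_simp
  -- positivity of `S` and consequences
  have hS : 0 < S := by rw [hnorm]; exact mul_pos (by exact_mod_cast P'.deg_pos) hV
  have hne : P'.form ≠ 0 := by
    intro h0
    have : S = 0 := by
      rw [hSdef, h0]
      simp [ShimuraCurveData.normSq, peterssonNormSq]
    exact hS.ne' this
  have hint : IntegrableOn (fun z : UpperHalfPlane => ‖P'.form z‖ ^ 2 * z.im ^ 2) X.fd := by
    by_contra hni
    have : S = 0 := integral_undef hni
    exact hS.ne' this
  -- the volume
  have hv := hvol X hMpos
  set vol : ℝ := (volume X.fd).toReal with hvoldef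
  have hφψ : ((p * q * M : ℕ) : ℝ) ≤ ((Nat.totient (p * q) * gamma0Index M : ℕ) : ℝ) * 4 := by
    have h1 : p * q ≤ Nat.totient (p * q) * 4 := mul_le_totient_mul_four hpP hqP hpq
    have h2 : M ≤ gamma0Index M := le_gamma0Index M hMpos.ne'
    have : p * q * M ≤ Nat.totient (p * q) * gamma0Index M * 4 := by
      calc p * q * M ≤ (Nat.totient (p * q) * 4) * gamma0Index M := Nat.mul_le_mul h1 h2
        _ = Nat.totient (p * q) * gamma0Index M * 4 := by ring
    exact_mod_cast this
  have hvoleq : vol = Real.pi / 3 * ((Nat.totient (p * q) * gamma0Index M : ℕ) : ℝ) := by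
    rw [hvoldef, hv, ENNReal.toReal_ofReal (by positivity)]
  have hvol0 : 0 < vol := by
    rw [hvoleq]
    have : 0 < Nat.totient (p * q) * gamma0Index M :=
      Nat.mul_pos (Nat.totient_pos.mpr hadm.pos_left)
        (hMpos.trans_le (le_gamma0Index M hMpos.ne'))
    positivity
  have hvolb : Real.pi / 3 * (N : ℝ) ≤ vol * 4 := by
    rw [hvoleq, ← hDM]
    have hπ : 0 ≤ Real.pi / 3 := by positivity
    calc Real.pi / 3 * ((p * q * M : ℕ) : ℝ)
        ≤ Real.pi / 3 * (((Nat.totient (p * q) * gamma0Index M : ℕ) : ℝ) * 4) :=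
          mul_le_mul_of_nonneg_left hφψ hπ
      _ = _ := by ring
  -- the (trivial) divisor bound `4 ≤ 4 N^η`
  have hdiv : (4 : ℝ) ≤ 4 * (N : ℝ) ^ η :=
    le_mul_of_one_le_right (by norm_num) (Real.one_le_rpow hN1 hη.le)
  -- the logarithmic chain
  have hKg : 0 < K * (g : ℝ) ^ 2 := by positivity
  have hlogT := log_chain (ω := 2) (κ := 1) (Cη := 4) (twoω := 4) (by exact_mod_cast hT1) hchain'
    hKg hS le_rfl (by rw [Real.rpow_one]; norm_num) hN1 (by norm_num) (by norm_num) hdiv hvol0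
    hvolb
  have hlogKg : Real.log (K * (g : ℝ) ^ 2) = Real.log K + 2 * Real.log g := by
    rw [Real.log_mul hK.ne' (by positivity), Real.log_pow]
    push_cast
    ring
  have hεη : ((1 : ℝ) + 2) * η = ε := by rw [hηdef]; ring
  rw [hlogKg, hεη] at hlogT
  have hfinal : Real.log (T : ℝ) ≤ Real.log K + 2 * Real.log 4 + Real.log (3 / Real.pi) +
      ε * Real.log N + 2 * Real.log g + Real.log vol - Real.log S := by linarith
  exact ⟨P'.L, X, X.fd, P'.form, ⟨C₀, hC₀, P'.isNeronLattice⟩, X.isHypFundamentalDomain_fd,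
    by rw [hv]; exact (ENNReal.ofReal_pos.mpr (by rw [← hvoleq]; exact hvol0)).ne',
    by rw [hv]; exact ENNReal.ofReal_ne_top, hne, P'.period_mem, hint, hS, hfinal⟩

end Summit.ABC.ABC.Theorems.FewPrimeValuationProduct

end
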